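import Summits.ResolutionOfSingularities.ResolutionOfSingularities.Theorems.WildQuotientsSummitReductionStubPairOrbitBlowupCentreLocalLemmas9
import Summits.ResolutionOfSingularities.ResolutionOfSingularities.Theorems.WildQuotientsSummitReductionStubPairOrbitBlowupCentreLocalLemmas10
import Summits.ResolutionOfSingularities.ResolutionOfSingularities.Theorems.WildQuotientsSummitReductionStubPairOrbitBlowupCentreLocalLemmas12
import Summits.ResolutionOfSingularities.ResolutionOfSingularities.Theorems.WildQuotientsSummitReductionStubPairOrbitBlowupCentreLocalLemmas17
import Literature.AlgebraicGeometry.Resolution.AlterationsSingularComponents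
import HarnessLib

/-!
# `WildQuotients.SummitReduction` (stmt-ResolutionOfSingularities-16324), line `FramePerfect`:
# the fibre local ring of a base change at a rational point over a non-origin of the chart is
# regular of dimension one — the algebra (stub `stub_pair_orbitBlowupCentreLocal`, file 18)

Route `ResolutionOfSingularities/WildQuotients`, crux `SummitReduction`; helper file of stub
`stub_pair_orbitBlowupCentreLocal` (C2: de Jong 1996, 3.4 Claim (ii) over the orbit centre). Clause
(H2) of the stub: the closed points over the centre of the geometric fibres `X₁ ×_Y Spec K` of
the blown-up curve are nonsingular points of curves or ordinary double points. At a point `x̄'`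
over a point `x'` whose chart prime is the origin this is file 7 (an ordinary double point); this
file PROVES the algebra of the other case (`isRegularLocalRing_and_ringKrullDim_fibreRing_of_chart`):
in the abstract base-change square of stub QS (`R → O`, `R → R'`, `R' → O'`, `O → O'`, local
rings of a point of `X ×_Y Y'`), given the chart comparison `Ô ≅ T̂` at `x'` over Cohen
coordinates of `R` with chart prime `𝔔 ∌ x̄` or `∌ ȳ`, and RATIONALITY of `x̄'` (`R' → O' → κ(x̄')`
onto — a closed point of a geometric fibre), **the fibre local ring `B' = O'/𝔪_{R'}O'` is regular
of dimension `1`** ("This scheme is smooth over `k`, except at the maximal ideal `(u, t₁')`",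
de Jong 1996, p. 64, at the `K`-points): `B'` is a local ring of `κ' ⊗_κ B` at a `κ'`-rational
prime over `𝔪_B` (file 17), whose completion is by the engine (file 9, fed by file 12) that of a
local ring of `κ'[x, y]/(xy - ā)` at a rational prime off the origin — regular of dimension `1`
(file 10) — and regularity and dimension are read off the completion.
-/

set_option linter.dupNamespace false

noncomputable section

open IsLocalRing TensorProduct
open Literature.AlgebraicGeometry.Resolution
open Literature.AlgebraicGeometry.Resolution.DeJong1996

namespace Summit.ResolutionOfSingularities.ResolutionOfSingularities.Theorems

universe u

set_option maxHeartbeats 1600000 in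
/-- **The fibre local ring of a base change at a rational point over a non-origin of the chart is
regular of dimension `1`.** In the abstract base-change square of stub QS (local homomorphisms
`φ : R → O`, `ρ : R → R'`, `φ' : R' → O'`, `π : O → O'` with `φ' ∘ ρ = π ∘ φ`, the corners
localizations of rings of sections `A`, `C`, `A'`, `C ⊗_A A'` compatibly; `O`, `O'` Noetherian),
suppose `Ô ≅ T̂` compatibly with `R → Λ → T` for Cohen coordinates `β : R → Λ` (`𝔪_R Λ = 𝔪_Λ`,
residually onto) and a local ring `T` of the chart `Λ[x, y]/(xy - a₀)` at a prime `𝔔 ⊇ 𝔪_Λ` with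
`𝔔 ∌ x̄` or `𝔔 ∌ ȳ`, and suppose `R' → O' → O'/𝔪_{O'}` is onto. Then `O'/𝔪_{R'}O'` is a regular
local ring of dimension `1`. [cite: DeJong1996, 3.4 Claim (ii), p. 64] -/
theorem isRegularLocalRing_and_ringKrullDim_fibreRing_of_chart
    {A C A' : Type u} [CommRing A] [CommRing C] [CommRing A'] [Algebra A C] [Algebra A A']
    {R O R' O' : Type u} [CommRing R] [CommRing O] [CommRing R'] [CommRing O']
    [IsLocalRing R] [IsLocalRing O] [IsLocalRing R'] [IsLocalRing O'] [IsNoetherianRing O]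
    [IsNoetherianRing O'] (φ : R →+* O) (ρ : R →+* R') (φ' : R' →+* O') (π : O →+* O')
    [IsLocalHom φ] [IsLocalHom ρ] [IsLocalHom φ'] [IsLocalHom π]
    (γA : A →+* R) (γC : C →+* O) (γA' : A' →+* R') (σ : C ⊗[A] A' →+* O')
    (hsq : ∀ r, φ' (ρ r) = π (φ r))
    (h0a : ∀ a, γC (algebraMap A C a) = φ (γA a)) (h0b : ∀ a, γA' (algebraMap A A' a) = ρ (γA a))
    (h1 : ∀ c, σ (c ⊗ₜ 1) = π (γC c)) (h2 : ∀ a', σ (1 ⊗ₜ a') = φ' (γA' a'))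
    (hO : ∀ o : O, ∃ c₁ c₂ : C, IsUnit (γC c₂) ∧ o * γC c₂ = γC c₁)
    (hR' : ∀ r : R', ∃ a₁ a₂ : A', IsUnit (γA' a₂) ∧ r * γA' a₂ = γA' a₁)
    (hR'' : maximalIdeal R' ≤ ((maximalIdeal R').comap γA').map γA')
    (hO'₁ : ∀ o : O', ∃ s u, IsUnit (σ u) ∧ o * σ u = σ s)
    (hO'₂ : ∀ (I : Ideal (C ⊗[A] A')) (s), σ s ∈ I.map σ → ∃ u, IsUnit (σ u) ∧ u * s ∈ I)
    {Λ : Type u} [CommRing Λ] [IsLocalRing Λ] (β : R →+* Λ)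
    (hβM : (maximalIdeal R).map β = maximalIdeal Λ)
    (hβR : Function.Surjective ((Ideal.Quotient.mk (maximalIdeal Λ)).comp β))
    {a₀ : Λ} (𝔔 : Ideal (AlgebraicNodeRing Λ a₀)) [𝔔.IsPrime] (T : Type u) [CommRing T]
    [IsLocalRing T] [IsNoetherianRing T] [Algebra (AlgebraicNodeRing Λ a₀) T]
    [IsLocalization.AtPrime T 𝔔] [Algebra Λ T] [IsScalarTower Λ (AlgebraicNodeRing Λ a₀) T]
    (h𝔔Λ : (maximalIdeal Λ).map (algebraMap Λ (AlgebraicNodeRing Λ a₀)) ≤ 𝔔)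
    (E : LocalCpl O ≃+* LocalCpl T)
    (hE : ∀ a, E (AdicCompletion.of _ _ (φ a)) = AdicCompletion.of _ _ (algebraMap Λ T (β a)))
    (hoff : ¬ (AlgebraicNodeRing.u Λ a₀ ∈ 𝔔 ∧ AlgebraicNodeRing.v Λ a₀ ∈ 𝔔))
    (hrat : Function.Surjective ((IsLocalRing.residue O').comp φ')) :
    IsRegularLocalRing (O' ⧸ (maximalIdeal R').map φ') ∧
      ringKrullDim (O' ⧸ (maximalIdeal R').map φ') = 1 := by
  classical
  have hρ : maximalIdeal R ≤ (maximalIdeal R').comap ρ := ((local_hom_TFAE ρ).out 0 3).mp ‹IsLocalHom ρ›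
  -- the residue fields `κ = R/𝔪_R`, `κ' = R'/𝔪_{R'}` and the fibre rings `B`, `B'`
  letI fκ : Field (R ⧸ maximalIdeal R) := Ideal.Quotient.field _
  letI fκ' : Field (R' ⧸ maximalIdeal R') := Ideal.Quotient.field _
  letI aκκ' : Algebra (R ⧸ maximalIdeal R) (R' ⧸ maximalIdeal R') := (Ideal.quotientMap _ ρ hρ).toAlgebra
  letI aκB : Algebra (R ⧸ maximalIdeal R) (O ⧸ (maximalIdeal R).map φ) :=
    (Ideal.quotientMap _ φ Ideal.le_comap_map).toAlgebra
  letI aκ'B' : Algebra (R' ⧸ maximalIdeal R') (O' ⧸ (maximalIdeal R').map φ') :=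
    (Ideal.quotientMap _ φ' Ideal.le_comap_map).toAlgebra
  letI aκB' : Algebra (R ⧸ maximalIdeal R) (O' ⧸ (maximalIdeal R').map φ') :=
    ((algebraMap (R' ⧸ maximalIdeal R') (O' ⧸ (maximalIdeal R').map φ')).comp
      (algebraMap (R ⧸ maximalIdeal R) (R' ⧸ maximalIdeal R'))).toAlgebra
  haveI : IsScalarTower (R ⧸ maximalIdeal R) (R' ⧸ maximalIdeal R') (O' ⧸ (maximalIdeal R').map φ') :=
    IsScalarTower.of_algebraMap_eq (fun _ => rfl)
  -- `B'` and `B` are local, with local quotient maps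
  have hI' : (maximalIdeal R').map φ' ≠ ⊤ := fun htop => by
    have hle : (maximalIdeal R').map φ' ≤ maximalIdeal O' := ((local_hom_TFAE φ').out 0 2).mp ‹IsLocalHom φ'›
    rw [htop, top_le_iff] at hle
    exact (maximalIdeal.isMaximal _).ne_top hle
  haveI : Nontrivial (O' ⧸ (maximalIdeal R').map φ') := Ideal.Quotient.nontrivial_iff.mpr hI'
  haveI : IsLocalRing (O' ⧸ (maximalIdeal R').map φ') :=
    IsLocalRing.of_surjective' (Ideal.Quotient.mk _) Ideal.Quotient.mk_surjective
  haveI hmk'loc : IsLocalHom (Ideal.Quotient.mk ((maximalIdeal R').map φ')) :=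
    IsLocalHom.of_surjective _ Ideal.Quotient.mk_surjective
  have hI : (maximalIdeal R).map φ ≠ ⊤ := fun htop => by
    have hle : (maximalIdeal R).map φ ≤ maximalIdeal O := ((local_hom_TFAE φ).out 0 2).mp ‹IsLocalHom φ›
    rw [htop, top_le_iff] at hle
    exact (maximalIdeal.isMaximal _).ne_top hle
  haveI : Nontrivial (O ⧸ (maximalIdeal R).map φ) := Ideal.Quotient.nontrivial_iff.mpr hI
  haveI : IsLocalRing (O ⧸ (maximalIdeal R).map φ) :=
    IsLocalRing.of_surjective' (Ideal.Quotient.mk _) Ideal.Quotient.mk_surjective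
  have hle : (maximalIdeal R).map φ ≤ ((maximalIdeal R').map φ').comap π := by
    rw [Ideal.map_le_iff_le_comap]
    intro r hr
    rw [Ideal.mem_comap, Ideal.mem_comap, ← hsq]
    exact Ideal.mem_map_of_mem φ' (hρ hr)
  have h𝔭B : (maximalIdeal O).map (Ideal.Quotient.mk ((maximalIdeal R).map φ)) = maximalIdeal _ :=
    IsLocalRing.map_maximalIdeal_of_surjective _ Ideal.Quotient.mk_surjective
  have h𝔭B' : (maximalIdeal O').map (Ideal.Quotient.mk ((maximalIdeal R').map φ')) = maximalIdeal _ :=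
    IsLocalRing.map_maximalIdeal_of_surjective _ Ideal.Quotient.mk_surjective
  -- `B'` is a localization of `κ' ⊗ B` at `𝔑 = h⁻¹ 𝔪_{B'}` (file 17)
  obtain ⟨h, hh, h𝔑le, hrat', hloc⟩ := exists_isLocalization_fibreRing_comap φ ρ φ' π γA γC γA' σ
    (Ideal.Quotient.mk (maximalIdeal R)) (Ideal.Quotient.mk (maximalIdeal R'))
    (Ideal.Quotient.mk ((maximalIdeal R).map φ)) (Ideal.Quotient.mk ((maximalIdeal R').map φ'))
    (Ideal.quotientMap _ π hle) hsq h0a h0b h1 h2 hO hR' hR'' hO'₁ hO'₂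
    Ideal.Quotient.mk_surjective Ideal.Quotient.mk_surjective
    (fun r hr => Ideal.Quotient.eq_zero_iff_mem.mpr hr) Ideal.Quotient.mk_surjective
    Ideal.Quotient.mk_surjective (fun o ho => Ideal.Quotient.eq_zero_iff_mem.mp ho) (fun _ => rfl)
    (fun _ => rfl) (fun _ => rfl) (fun _ => rfl)
  letI := h.toAlgebra
  haveI : IsLocalization.AtPrime (O' ⧸ (maximalIdeal R').map φ')
    ((maximalIdeal (O' ⧸ (maximalIdeal R').map φ')).comap h) := hloc
  haveI : ((maximalIdeal (O' ⧸ (maximalIdeal R').map φ')).comap h).IsPrime := Ideal.comap_isPrime h _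
  -- the level data of `B` (file 12)
  obtain ⟨abar, 𝔔l, h𝔔lp, g₁, hu, hv, hg₁l, h₁, hb₁⟩ := exists_levelData_of_chart φ β hβM hβR 𝔔 h𝔔Λ E hE
    (R ⧸ maximalIdeal R) Ideal.Quotient.mk_surjective (fun a => Ideal.Quotient.eq_zero_iff_mem) (fun _ => rfl)
  haveI := h𝔔lp
  rw [h𝔭B] at h₁ hb₁
  obtain ⟨h₂, hb₂⟩ := map_maximalIdeal_and_levelBijective_localCpl (Localization.AtPrime 𝔔l)
  have h𝔑B : (maximalIdeal (O ⧸ (maximalIdeal R).map φ)).map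
      (tensorInr (R ⧸ maximalIdeal R) (R' ⧸ maximalIdeal R') _) ≤
      (maximalIdeal (O' ⧸ (maximalIdeal R').map φ')).comap h := by
    rw [← h𝔭B]; exact h𝔑le
  -- the engine (file 9)
  obtain ⟨𝔑', h𝔑'p, h𝔑'C, -, hratC, ⟨ε, -⟩⟩ := exists_localCpl_localization_baseChange_equiv
    (R' ⧸ maximalIdeal R') g₁ (algebraMap _ (LocalCpl (Localization.AtPrime 𝔔l)))
    (fun c => by rw [hg₁l]; rfl) h₁ h₂ hb₁ hb₂ _ h𝔑B
  haveI := h𝔑'p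
  -- rationality: of `B'`, hence of `𝔑`, hence of `𝔑'`
  have hratB' : Function.Surjective ((Ideal.Quotient.mk (maximalIdeal (O' ⧸ (maximalIdeal R').map φ'))).comp
      (algebraMap (R' ⧸ maximalIdeal R') (O' ⧸ (maximalIdeal R').map φ'))) := by
    intro z
    obtain ⟨b', rfl⟩ := Ideal.Quotient.mk_surjective z
    obtain ⟨o', rfl⟩ := Ideal.Quotient.mk_surjective b'
    obtain ⟨r', hr'⟩ := hrat (residue O' o')
    refine ⟨Ideal.Quotient.mk _ r', ?_⟩
    rw [RingHom.comp_apply, Ideal.Quotient.mk_eq_mk_iff_sub_mem]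
    change Ideal.Quotient.mk _ (φ' r') - Ideal.Quotient.mk _ o' ∈ _
    rw [← map_sub, ← h𝔭B']
    refine Ideal.mem_map_of_mem _ ?_
    rw [RingHom.comp_apply, ← sub_eq_zero, ← map_sub, residue_eq_zero_iff] at hr'
    exact hr'
  have hrat𝔑' := hratC (hrat' hratB')
  -- the model (file 10): regular of dimension one
  have hoff' : ¬ ((AlgEquiv.refl : AlgebraicNodeRing (R ⧸ maximalIdeal R) abar ≃ₐ[R ⧸ maximalIdeal R]
      AlgebraicNodeRing (R ⧸ maximalIdeal R) abar).symm (AlgebraicNodeRing.u (R ⧸ maximalIdeal R) abar) ∈ 𝔔l ∧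
      (AlgEquiv.refl : AlgebraicNodeRing (R ⧸ maximalIdeal R) abar ≃ₐ[R ⧸ maximalIdeal R]
      AlgebraicNodeRing (R ⧸ maximalIdeal R) abar).symm (AlgebraicNodeRing.v (R ⧸ maximalIdeal R) abar) ∈ 𝔔l) := by
    rw [AlgEquiv.refl_symm, AlgEquiv.coe_refl, id_eq, id_eq, hu, hv]
    exact hoff
  have hmodel := isRegularLocalRing_and_ringKrullDim_localization_baseChange (R ⧸ maximalIdeal R)
    (R' ⧸ maximalIdeal R') abar (AlgebraicNodeRing (R ⧸ maximalIdeal R) abar) AlgEquiv.refl 𝔔l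
    (Localization.AtPrime 𝔔l) 𝔑' h𝔑'C
  haveI hreg : IsRegularLocalRing (Localization.AtPrime 𝔑') := hmodel.1 hoff'
  have hdim : ringKrullDim (Localization.AtPrime 𝔑') = 1 := hmodel.2 hrat𝔑'
  -- transfer to `B' ≅ (κ' ⊗ B)_𝔑` through the completions
  let eL := IsLocalization.algEquiv ((maximalIdeal (O' ⧸ (maximalIdeal R').map φ')).comap h).primeCompl
    (Localization.AtPrime ((maximalIdeal (O' ⧸ (maximalIdeal R').map φ')).comap h))
    (O' ⧸ (maximalIdeal R').map φ')
  haveI : IsNoetherianRing (Localization.AtPrime ((maximalIdeal (O' ⧸ (maximalIdeal R').map φ')).comap h)) :=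
    isNoetherianRing_of_ringEquiv (O' ⧸ (maximalIdeal R').map φ') eL.symm.toRingEquiv
  haveI : IsRegularLocalRing (LocalCpl (Localization.AtPrime 𝔑')) := isRegularLocalRing_adicCompletion _
  haveI : IsRegularLocalRing (LocalCpl (Localization.AtPrime
      ((maximalIdeal (O' ⧸ (maximalIdeal R').map φ')).comap h))) :=
    IsRegularLocalRing.of_ringEquiv (R := LocalCpl (Localization.AtPrime 𝔑')) (R' := LocalCpl
      (Localization.AtPrime ((maximalIdeal (O' ⧸ (maximalIdeal R').map φ')).comap h))) ε.symm
  haveI hregL : IsRegularLocalRing (Localization.AtPrime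
      ((maximalIdeal (O' ⧸ (maximalIdeal R').map φ')).comap h)) :=
    isRegularLocalRing_of_isRegularLocalRing_adicCompletion inferInstance
  have hdimL : ringKrullDim (Localization.AtPrime ((maximalIdeal (O' ⧸ (maximalIdeal R').map φ')).comap h)) = 1 := by
    have e1 := ringKrullDim_adicCompletion
      (Localization.AtPrime ((maximalIdeal (O' ⧸ (maximalIdeal R').map φ')).comap h))
    have e2 := ringKrullDim_adicCompletion (Localization.AtPrime 𝔑')
    have e3 := ringKrullDim_eq_of_ringEquiv ε
    rw [← e1]
    exact e3.trans (e2.trans hdim)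
  refine ⟨IsRegularLocalRing.of_ringEquiv (R := Localization.AtPrime
      ((maximalIdeal (O' ⧸ (maximalIdeal R').map φ')).comap h)) (R' := O' ⧸ (maximalIdeal R').map φ')
      eL.toRingEquiv, ?_⟩
  rw [← ringKrullDim_eq_of_ringEquiv eL.toRingEquiv, hdimL]

end Summit.ResolutionOfSingularities.ResolutionOfSingularities.Theorems

end
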